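import Mathlib
import Summits.BirchSwinnertonDyer.BirchSwinnertonDyer.Theorems.ManinLocalTwoThreeOddDegreeRootNumber
import Literature.NumberTheory.EllipticCurves.GlobalMinimalModelProofs
import Literature.NumberTheory.EllipticCurves.SzpiroOfAbcProofs
import HarnessLib

/-!
# Root number `−1` ⟹ even modular degree / odd degree ⟹ even analytic rank — WITHOUT the global-minimality binder

Summit `BirchSwinnertonDyer`, sub-problem `BirchSwinnertonDyer`, route `ManinLocalTwoThree`; width seat `bsd-line-manin23-p2`
(gen 9), `--supports` the crux C2 `ManinOddAtFour` (stmt-BirchSwinnertonDyer-22967).  The seat's p659653/p659977 theorems carried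
`[W.IsGloballyMinimal]` only to invoke `conductorNorm_ne_one`; the conductor is a `VariableChange`-invariant
(`conductorNorm_smul_rat`) and every elliptic `W/ℚ` has a globally minimal model (`hasGlobalMinimalModel_rat_holds`), so the binder
is removed here.

PROVED here (no `sorry`): `conductorNorm_ne_one_of_isElliptic`, **`two_dvd_modularDegree_of_rootNumber_eq_neg_one'`**,
**`rootNumber_eq_one_of_odd_modularDegree'`**, **`even_analyticRank_of_odd_modularDegree'`** (any model).
BSD is not proved by this; Manin's conjecture is not proved by this.
-/

set_option autoImplicit false
set_option linter.dupNamespace false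

noncomputable section

open scoped MatrixGroups ModularForm
open CongruenceSubgroup
open Literature.NumberTheory.EllipticCurves Literature.NumberTheory.EllipticCurves.ModularForms

namespace Summit.BirchSwinnertonDyer.BirchSwinnertonDyer.Theorems.ManinLocalTwoThree

/-- **`N_W ≠ 1` for every elliptic `W/ℚ`** (Tate: no curve of conductor `1`; via a globally minimal model). -/
theorem conductorNorm_ne_one_of_isElliptic (W : WeierstrassCurve ℚ) [W.IsElliptic] : W.conductorNorm ℤ ≠ 1 := by
  obtain ⟨C, hC⟩ := WeierstrassCurve.hasGlobalMinimalModel_rat_holds W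
  haveI := hC
  rw [← WeierstrassCurve.conductorNorm_smul_rat W C]
  exact (C • W).conductorNorm_ne_one

/-- **Root number `−1` ⟹ even modular degree** (any model, any datum at the conductor). -/
theorem two_dvd_modularDegree_of_rootNumber_eq_neg_one' (W : WeierstrassCurve ℚ) [W.IsElliptic] [NeZero (W.conductorNorm ℤ)]
    (D : ModularParametrizationData W (W.conductorNorm ℤ)) (hw : W.rootNumber = -1) : 2 ∣ D.modularDegree :=
  two_dvd_modularDegree_of_frickeInvolution_eq_self (conductorNorm_ne_one_of_isElliptic W) D
    (frickeInvolution_eq_self_of_rootNumber_eq_neg_one W D.isNewformOf hw)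

/-- **Odd modular degree ⟹ root number `+1`** (any model). -/
theorem rootNumber_eq_one_of_odd_modularDegree' (W : WeierstrassCurve ℚ) [W.IsElliptic] [NeZero (W.conductorNorm ℤ)]
    (D : ModularParametrizationData W (W.conductorNorm ℤ)) (hodd : Odd D.modularDegree) : W.rootNumber = 1 := by
  rcases W.rootNumber_eq_one_or with h | h
  · exact h
  · exact absurd (even_iff_two_dvd.mpr (two_dvd_modularDegree_of_rootNumber_eq_neg_one' W D h))
      (Nat.not_even_iff_odd.mpr hodd)

/-- **Odd modular degree ⟹ even analytic rank** (any model). -/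
theorem even_analyticRank_of_odd_modularDegree' (W : WeierstrassCurve ℚ) [W.IsElliptic] [NeZero (W.conductorNorm ℤ)]
    (D : ModularParametrizationData W (W.conductorNorm ℤ)) (hodd : Odd D.modularDegree) : Even W.analyticRank :=
  (W.even_analyticRank_iff_of_hasFunctionalEquationSign D.isNewformOf.hasEntireLFunction
    (W.hasFunctionalEquationSign_rootNumber_of_isNewformOf D.isNewformOf)).mpr
    (rootNumber_eq_one_of_odd_modularDegree' W D hodd)

end Summit.BirchSwinnertonDyer.BirchSwinnertonDyer.Theorems.ManinLocalTwoThree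

end
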